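import Mathlib
import Literature.Analysis.FluidPDE.LerayProfileCalculus
import Literature.Analysis.FluidPDE.WholeSpaceIBP
import Literature.Analysis.FluidPDE.HomogeneousEulerProofs
import HarnessLib
/-!
# Radial and translation commutators: `Δ((y·∇)f) = (y·∇)Δf + 2Δf`, `∇((y·∇)q) = (y·∇)∇q + ∇q`,
# `(v·∇)((y·∇)v) + (((y·∇)v)·∇)v = (y·∇)((v·∇)v) + (v·∇)v`, `Δ(∂ₕf) = ∂ₕΔf`, `∇(∂ₕq) = ∂ₕ∇q`
# (zone Z1 TEMPLATE §T1.4-II (L4), calculus layer — kernel-checked)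

HONEST FRAMING (cell ns-blowup GROUP B «PROFILE SEARCH», zone Z1 «Type-II log-modulated DSS ansatz for axisymmetric
Navier–Stokes — the template IS the deliverable»; D-0035/D-0074): part VI-a of the Z1 dictionary. Pure calculus on a
finite-dimensional real inner product space `E`: the commutators of the scaling generator `y·∇` (the radial derivative
`y ↦ Df(y)y`) and of a translation generator `∂ₕ` with the three operators of the steady Navier–Stokes system (Laplacian,
pressure gradient, convective term). They are the calculus behind TEMPLATE (L4) («differentiate the steady equation along
the symmetry families»), used in part VI-b (`TypeIIInnerLimitSymmetry`). The radial ones are adapted from the tree's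
`Summits/NavierStokesRegularity/NavierStokesRegularity/Theorems/RellichScarScarRigidityScalingGeneratorLinearised.lean`,
where they are `private` and stated on `ℝ³`; here they are public and on any `E`.

* `fderiv_fderiv_apply_self_apply` — `∂ₐ((y·∇)f) = (y·∇)∂ₐf + ∂ₐf` (`f ∈ C²`);
* `laplacian_fderiv_apply_self` — `Δ((y·∇)f) = (y·∇)Δf + 2Δf` (`f ∈ C³`);
* `laplacian_fderiv_apply_const` — `Δ(∂ₕf) = ∂ₕ(Δf)` (`f ∈ C³`);
* `Shvydkoy2018.inner_gradient_left`, `inner_fderiv_gradient_apply` — Riesz bookkeeping `⟪∇q, w⟫ = Dq w`, `⟪D(∇q)v, a⟫ = D²q v a`;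
* `gradient_fderiv_apply_self` — `∇((y·∇)q) = (y·∇)∇q + ∇q` (`q ∈ C²`); `gradient_fderiv_apply_const` — `∇(∂ₕq) = ∂ₕ∇q`;
* `convect_fderiv_apply_self_add` — `(v·∇)((y·∇)v) + (((y·∇)v)·∇)v = (y·∇)((v·∇)v) + (v·∇)v` (`v ∈ C²`);
* `convect_fderiv_apply_const_add` — `(v·∇)(∂ₕv) + ((∂ₕv)·∇)v = ∂ₕ((v·∇)v)`; `fderiv_fderiv_apply_const_comm` — Schwarz.

**Nothing here mentions a fluid**: identities valid for every sufficiently differentiable map. «violates: n/a — dictionary»;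
bears_on LADDER-NS N5/Z1 → N1 linear core / N0⁻. Author: ns-blowup-profile-eng-1 g5, 2026-08-27.
-/

open Real Filter Topology Set InnerProductSpace
open scoped Laplacian RealInnerProductSpace ContDiff
open Literature.Analysis.FluidPDE

-- nested operator types (`E →L[ℝ] E →L[ℝ] E`)
set_option maxSynthPendingDepth 4

namespace Summit.NavierStokesRegularity.OSWSelfSimilar
namespace TypeIIModulationDictionary

/-! ### Radial and translation commutators -/

section Commutators

variable {E : Type*} [NormedAddCommGroup E] [InnerProductSpace ℝ E] [FiniteDimensional ℝ E]
variable {F : Type*} [NormedAddCommGroup F] [NormedSpace ℝ F]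
variable {F' : Type*} [NormedAddCommGroup F'] [InnerProductSpace ℝ F']

omit [FiniteDimensional ℝ E] in
/-- **`∂ₐ((y·∇)f) = (y·∇)(∂ₐf) + ∂ₐf`** for `f ∈ C²`: the derivative of the radial derivative `y ↦ Df(y)y` (product rule,
then Schwarz). [folklore] -/
theorem fderiv_fderiv_apply_self_apply {f : E → F} (hf : ContDiff ℝ 2 f) (y a : E) :
    fderiv ℝ (fun z => fderiv ℝ f z z) y a = fderiv ℝ (fun z => fderiv ℝ f z a) y y + fderiv ℝ f y a := by
  -- adapted from Summits/…/RellichScarScarRigidityScalingGeneratorLinearised.lean (private there, on ℝ³)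
  have hD : HasFDerivAt (fderiv ℝ f) (fderiv ℝ (fderiv ℝ f) y) y :=
    (((hf.fderiv_right (m := 1) le_rfl).differentiable one_ne_zero) y).hasFDerivAt
  have hg : HasFDerivAt (fun z => fderiv ℝ f z z)
      ((fderiv ℝ f y).comp (ContinuousLinearMap.id ℝ E) + (fderiv ℝ (fderiv ℝ f) y).flip y) y :=
    hD.clm_apply (hasFDerivAt_id y)
  rw [hg.fderiv, add_apply, ContinuousLinearMap.comp_apply,
    ContinuousLinearMap.id_apply, ContinuousLinearMap.flip_apply, fderiv_fderiv_apply_eq hf y a, add_comm]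

/-- **`Δ((y·∇)f) = (y·∇)(Δf) + 2Δf`** for `f ∈ C³` (apply `∂ᵢ((y·∇)f) = (y·∇)∂ᵢf + ∂ᵢf` twice and sum over an
orthonormal basis). [folklore] -/
theorem laplacian_fderiv_apply_self {f : E → F'} (hf : ContDiff ℝ 3 f) (x : E) :
    (Δ (fun y => fderiv ℝ f y y)) x = fderiv ℝ (Δ f) x x + (2 : ℝ) • (Δ f) x := by
  -- adapted from Summits/…/RellichScarScarRigidityScalingGeneratorLinearised.lean (private there, on ℝ³)
  set b := stdOrthonormalBasis ℝ E
  have hf2 : ContDiff ℝ 2 f := hf.of_le (by norm_num)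
  have hφ : ∀ a : E, ContDiff ℝ 2 (fun z => fderiv ℝ f z a) := fun a =>
    (hf.fderiv_right (m := 2) le_rfl).clm_apply contDiff_const
  have hψ : ∀ a c : E, ContDiff ℝ 1 (fun y => fderiv ℝ (fun z => fderiv ℝ f z a) y c) := fun a c =>
    ((hφ a).fderiv_right (m := 1) le_rfl).clm_apply contDiff_const
  have hg : ContDiff ℝ 2 (fun y => fderiv ℝ f y y) :=
    (hf.fderiv_right (m := 2) le_rfl).clm_apply contDiff_id
  have h1 : ∀ a : E, (fun y => fderiv ℝ (fun z => fderiv ℝ f z z) y a) =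
      fun y => fderiv ℝ (fun z => fderiv ℝ f z a) y y + fderiv ℝ f y a := fun a =>
    funext fun y => fderiv_fderiv_apply_self_apply hf2 y a
  have h2 : ∀ a : E, fderiv ℝ (fun y => fderiv ℝ (fun z => fderiv ℝ f z z) y a) x a =
      fderiv ℝ (fun y => fderiv ℝ (fun z => fderiv ℝ f z a) y a) x x
        + (2 : ℝ) • fderiv ℝ (fun z => fderiv ℝ f z a) x a := by
    intro a
    have hd1 : DifferentiableAt ℝ (fun y => fderiv ℝ (fun z => fderiv ℝ f z a) y y) x :=
      ((((hφ a).fderiv_right (m := 1) le_rfl).differentiable one_ne_zero) x).clm_apply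
        differentiableAt_id
    have hd2 : DifferentiableAt ℝ (fun z => fderiv ℝ f z a) x := ((hφ a).differentiable two_ne_zero) x
    rw [h1 a, fderiv_fun_add hd1 hd2, add_apply,
      fderiv_fderiv_apply_self_apply (hφ a) x a, two_smul]
    abel
  rw [laplacian_eq_sum_fderiv_fderiv b hg x]
  simp_rw [h2]
  rw [Finset.sum_add_distrib, ← Finset.smul_sum]
  have hΔ : Δ f = fun y => ∑ i, fderiv ℝ (fun z => fderiv ℝ f z (b i)) y (b i) :=
    funext fun y => laplacian_eq_sum_fderiv_fderiv b hf2 y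
  rw [hΔ, fderiv_fun_sum fun i _ => ((hψ (b i) (b i)).differentiable one_ne_zero) x,
    sum_apply]

/-- **`Δ(∂ₕf) = ∂ₕ(Δf)`** for `f ∈ C³` and a fixed direction `h` (Schwarz, summed over an orthonormal basis).
[folklore] -/
theorem laplacian_fderiv_apply_const {f : E → F'} (hf : ContDiff ℝ 3 f) (x h : E) :
    (Δ (fun y => fderiv ℝ f y h)) x = fderiv ℝ (Δ f) x h := by
  set b := stdOrthonormalBasis ℝ E
  have hf2 : ContDiff ℝ 2 f := hf.of_le (by norm_num)
  have hφ : ∀ a : E, ContDiff ℝ 2 (fun z => fderiv ℝ f z a) := fun a =>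
    (hf.fderiv_right (m := 2) le_rfl).clm_apply contDiff_const
  have hψ : ∀ a c : E, ContDiff ℝ 1 (fun y => fderiv ℝ (fun z => fderiv ℝ f z a) y c) := fun a c =>
    ((hφ a).fderiv_right (m := 1) le_rfl).clm_apply contDiff_const
  -- `∂ₐ∂ₕ f = ∂ₕ∂ₐ f` as functions
  have h1 : ∀ a : E, (fun y => fderiv ℝ (fun z => fderiv ℝ f z h) y a) =
      fun y => fderiv ℝ (fun z => fderiv ℝ f z a) y h := by
    intro a
    funext y
    rw [fderiv_fderiv_apply_eq hf2 y h, fderiv_fderiv_apply_eq hf2 y a]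
    exact (hf2.contDiffAt.isSymmSndFDerivAt (n := 2) (by simp)) h a
  -- `∂ₐ(∂ₐ∂ₕ f) = ∂ₕ(∂ₐ∂ₐ f)`
  have h2 : ∀ a : E, fderiv ℝ (fun y => fderiv ℝ (fun z => fderiv ℝ f z h) y a) x a =
      fderiv ℝ (fun y => fderiv ℝ (fun z => fderiv ℝ f z a) y a) x h := by
    intro a
    rw [h1 a, fderiv_fderiv_apply_eq (hφ a) x h, fderiv_fderiv_apply_eq (hφ a) x a]
    exact ((hφ a).contDiffAt.isSymmSndFDerivAt (n := 2) (by simp)) h a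
  rw [laplacian_eq_sum_fderiv_fderiv b (hφ h) x]
  simp_rw [h2]
  have hΔ : Δ f = fun y => ∑ i, fderiv ℝ (fun z => fderiv ℝ f z (b i)) y (b i) :=
    funext fun y => laplacian_eq_sum_fderiv_fderiv b hf2 y
  rw [hΔ, fderiv_fun_sum fun i _ => ((hψ (b i) (b i)).differentiable one_ne_zero) x,
    sum_apply]

/-- `⟪D(∇q)(x) v, a⟫ = D²q(x)(v)(a)`: the derivative of the gradient is the Riesz image of the second derivative
(no differentiability hypothesis: both sides are junk-compatible). [folklore] -/
theorem inner_fderiv_gradient_apply {q : E → ℝ} (x v a : E) :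
    ⟪fderiv ℝ (gradient q) x v, a⟫ = fderiv ℝ (fderiv ℝ q) x v a := by
  have e : gradient q = (InnerProductSpace.toDual ℝ E).symm ∘ fderiv ℝ q := rfl
  have hDg : fderiv ℝ (gradient q) x v = (InnerProductSpace.toDual ℝ E).symm (fderiv ℝ (fderiv ℝ q) x v) := by
    rw [e, LinearIsometryEquiv.comp_fderiv]
    rfl
  rw [hDg, InnerProductSpace.toDual_symm_apply]

/-- **`∇((y·∇)q) = (y·∇)(∇q) + ∇q`** for a scalar `q ∈ C²`. [folklore] -/
theorem gradient_fderiv_apply_self {q : E → ℝ} (hq : ContDiff ℝ 2 q) (x : E) :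
    gradient (fun y => fderiv ℝ q y y) x = fderiv ℝ (gradient q) x x + gradient q x := by
  -- adapted from Summits/…/RellichScarScarRigidityScalingGeneratorLinearised.lean (private there, on ℝ³)
  refine ext_inner_right ℝ fun a => ?_
  rw [Shvydkoy2018.inner_gradient_left, inner_add_left, Shvydkoy2018.inner_gradient_left, inner_fderiv_gradient_apply,
    fderiv_fderiv_apply_self_apply hq x a, fderiv_fderiv_apply_eq hq x a]
  congr 1
  exact (hq.contDiffAt.isSymmSndFDerivAt (n := 2) (by simp)) a x

/-- **`∇(∂ₕq) = ∂ₕ(∇q)`** for a scalar `q ∈ C²` and a fixed direction `h`. [folklore] -/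
theorem gradient_fderiv_apply_const {q : E → ℝ} (hq : ContDiff ℝ 2 q) (x h : E) :
    gradient (fun y => fderiv ℝ q y h) x = fderiv ℝ (gradient q) x h := by
  refine ext_inner_right ℝ fun a => ?_
  rw [Shvydkoy2018.inner_gradient_left, inner_fderiv_gradient_apply, fderiv_fderiv_apply_eq hq x h]

omit [FiniteDimensional ℝ E] in
/-- **`(v·∇)((y·∇)v) + (((y·∇)v)·∇)v = (y·∇)((v·∇)v) + (v·∇)v`** for `v ∈ C²`: the radial derivative is a derivation up
to the commutator `[∂, y·∇] = ∂`. [folklore] -/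
theorem convect_fderiv_apply_self_add {v : E → E} (hv : ContDiff ℝ 2 v) (x : E) :
    fderiv ℝ (fun y => fderiv ℝ v y y) x (v x) + fderiv ℝ v x (fderiv ℝ v x x) =
      fderiv ℝ (fun y => fderiv ℝ v y (v y)) x x + fderiv ℝ v x (v x) := by
  -- adapted from Summits/…/RellichScarScarRigidityScalingGeneratorLinearised.lean (private there, on ℝ³)
  have hd : DifferentiableAt ℝ v x := (hv.differentiable two_ne_zero) x
  have hD : DifferentiableAt ℝ (fderiv ℝ v) x :=
    ((hv.fderiv_right (m := 1) le_rfl).differentiable one_ne_zero) x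
  have h1 : fderiv ℝ (fun y => fderiv ℝ v y y) x (v x)
      = fderiv ℝ (fun z => fderiv ℝ v z (v x)) x x + fderiv ℝ v x (v x) :=
    fderiv_fderiv_apply_self_apply hv x (v x)
  have h2 : fderiv ℝ (fun y => fderiv ℝ v y (v y)) x x
      = fderiv ℝ v x (fderiv ℝ v x x) + fderiv ℝ (fderiv ℝ v) x x (v x) := by
    rw [fderiv_clm_apply hD hd, add_apply, ContinuousLinearMap.comp_apply,
      ContinuousLinearMap.flip_apply]
  have h3 : fderiv ℝ (fun z => fderiv ℝ v z (v x)) x x = fderiv ℝ (fderiv ℝ v) x x (v x) := by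
    rw [fderiv_fderiv_apply_eq hv x (v x)]
    exact (hv.contDiffAt.isSymmSndFDerivAt (n := 2) (by simp)) (v x) x
  rw [h1, h2, h3]
  abel

omit [FiniteDimensional ℝ E] in
/-- **`(W·∇)(∂ₕW) + ((∂ₕW)·∇)W = ∂ₕ((W·∇)W)`** for `W ∈ C²` and a fixed direction `h` (product rule + Schwarz).
[folklore] -/
theorem convect_fderiv_apply_const_add {v : E → E} (hv : ContDiff ℝ 2 v) (x h : E) :
    fderiv ℝ (fun y => fderiv ℝ v y h) x (v x) + fderiv ℝ v x (fderiv ℝ v x h) =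
      fderiv ℝ (fun y => fderiv ℝ v y (v y)) x h := by
  have hd : DifferentiableAt ℝ v x := (hv.differentiable two_ne_zero) x
  have hD : DifferentiableAt ℝ (fderiv ℝ v) x :=
    ((hv.fderiv_right (m := 1) le_rfl).differentiable one_ne_zero) x
  rw [fderiv_clm_apply hD hd, add_apply, ContinuousLinearMap.comp_apply,
    ContinuousLinearMap.flip_apply, fderiv_fderiv_apply_eq hv x h]
  abel

omit [FiniteDimensional ℝ E] in
/-- **`∂_ζ(∂ₕW) = ∂ₕ(∂_ζW)`** (Schwarz) for `W ∈ C²`. [folklore] -/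
theorem fderiv_fderiv_apply_const_comm {v : E → F} (hv : ContDiff ℝ 2 v) (x h ζ : E) :
    fderiv ℝ (fun y => fderiv ℝ v y h) x ζ = fderiv ℝ (fun y => fderiv ℝ v y ζ) x h := by
  rw [fderiv_fderiv_apply_eq hv x h, fderiv_fderiv_apply_eq hv x ζ]
  exact (hv.contDiffAt.isSymmSndFDerivAt (n := 2) (by simp)) h ζ

end Commutators

end TypeIIModulationDictionary
end Summit.NavierStokesRegularity.OSWSelfSimilar
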